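import Summits.BirchSwinnertonDyer.Rank1Residual.F1Sign2.EggLemmaAtTwo
import Literature.NumberTheory.EllipticCurves.QuadraticTwistRank
import HarnessLib

/-!
# The EGG LEMMA, kernel-checked (cell `bsd-f1-sign2`, seat `-an` g5; MEMO-an v1.10 §2 AN-13) — PROOF FILE

PROOF FILE (typer seat `bsd-f1-sign2-ty` g2, D-ty-10): theorems only + two auxiliary polynomial functions (`psiTwo`,
`dupNum`, definitions with bodies); no candidate statement, no named fact, 0 sorry. Source: -an g5's
`HOME/MEMO-an-data/g5/EggDoubling.lean` c390bffaaea95605 (rc 0 / 0 warn; check json `g5/EggDoubling_check.json`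
7bffb71ae0b4e566), re-filed VERBATIM except that its final section (byte-copies of the three `def`s of
`EggLemmaAtTwo.lean`) is replaced by the import, so `eggLemma` below proves the TREE statement
`Summit.BirchSwinnertonDyer.Rank1Residual.F1Sign2.EggLemma`. Helper names live in the sub-namespace `…F1Sign2.EggDoubling`.

Main results (all sorry-free): `not_onEgg_of_two_smul_eq` — **`2E(ℚ)` misses the egg** (for every root `e` of the
2-division cubic `ψ₂`, `4·(X(2Q) − e)·ψ₂(x) = (2x² − 4ex − (b₄ + b₂e + 4e²))²` and `ψ₂(x) = (2y + a₁x + a₃)²`; so the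
real-component map `E(ℚ) → π₀(E(ℝ))` kills `2E(ℚ)` — well-definedness of -desc's descent sign `ε`);
`torsion_eq_two_smul`, `onEgg_not_two_smul_add_torsion` — RATIONAL EGG LEMMA (under `NoRationalTwoTorsion` every
rational torsion point is 2-divisible, so a rational point on the egg is not in `2E(ℚ) + E(ℚ)_tors`);
`psiTwo_baseChange_ne_zero`, `eq_zero_of_two_smul_eq_zero_baseChange` — **`E(K)[2] = 0` for `[K : ℚ] = 2`** under
`NoRationalTwoTorsion`; `exists_incl_eq_of_two_smul` — Galois descent of halves (`R ∈ E(ℚ)`, `R = 2Q'` in `E(K)` ⇒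
`Q' ∈ E(ℚ)`, via the tree's `QuadraticDescent.conjMap`); `onEgg_not_two_smul_add_torsion_quadratic` and
`eggLemma : EggLemma` — the EGG LEMMA of AN-13 is a THEOREM (the hypotheses `0 < Δ`, `IsElliptic`, `K` imaginary of
the audited statement are not used). Consequence: AN-13 ⇒ AN-13′ (`HeegnerPointOnEggAtTwo` ⇒ Kolyvagin's class
`c(1) = δ(y_K) ≠ 0`) is unconditional in its first argument.
[cite: SilvermanAEC2009, III.2.3(d) duplication formula; X.1 (Kummer sequence)] Sorry-free.
-/

noncomputable section

namespace Summit.BirchSwinnertonDyer.Rank1Residual.F1Sign2.EggDoubling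

set_option autoImplicit false
set_option linter.dupNamespace false

variable {F : Type*} [Field F]

/-- The `2`-division cubic `ψ₂(X) = 4X³ + b₂X² + 2b₄X + b₆` as a function. -/
def psiTwo (W : WeierstrassCurve F) (x : F) : F :=
  4 * x ^ 3 + W.b₂ * x ^ 2 + 2 * W.b₄ * x + W.b₆

/-- The duplication numerator `X⁴ − b₄X² − 2b₆X − b₈`. -/
def dupNum (W : WeierstrassCurve F) (x : F) : F :=
  x ^ 4 - W.b₄ * x ^ 2 - 2 * W.b₆ * x - W.b₈

/-- On the curve, `(y − negY)² = (2y + a₁x + a₃)² = ψ₂(x)`. -/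
theorem sub_negY_sq_eq_psiTwo (W : WeierstrassCurve F) {x y : F} (h : W.toAffine.Equation x y) :
    (y - W.toAffine.negY x y) ^ 2 = psiTwo W x := by
  rw [WeierstrassCurve.Affine.equation_iff] at h
  rw [WeierstrassCurve.Affine.negY, psiTwo, WeierstrassCurve.b₂, WeierstrassCurve.b₄, WeierstrassCurve.b₆]
  linear_combination 4 * h

/-- **Duplication formula** (multiplied out): `X(2Q) · ψ₂(x) = x⁴ − b₄x² − 2b₆x − b₈` for `Q = (x, y)` with
`y ≠ negY` (i.e. `2Q ≠ 0`). -/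
theorem addX_self_mul_psiTwo [DecidableEq F] (W : WeierstrassCurve F) {x y : F} (h : W.toAffine.Equation x y)
    (hy : y ≠ W.toAffine.negY x y) :
    W.toAffine.addX x x (W.toAffine.slope x x y y) * psiTwo W x = dupNum W x := by
  have hD : y - W.toAffine.negY x y ≠ 0 := sub_ne_zero.mpr hy
  have hℓ : W.toAffine.slope x x y y * (y - W.toAffine.negY x y) =
      3 * x ^ 2 + 2 * W.a₂ * x + W.a₄ - W.a₁ * y := by
    rw [WeierstrassCurve.Affine.slope_of_Y_ne rfl hy, div_mul_cancel₀ _ hD]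
  have hsq := sub_negY_sq_eq_psiTwo W h
  rw [WeierstrassCurve.Affine.equation_iff] at h
  set ℓ := W.toAffine.slope x x y y with hℓdef
  have hD' : y - W.toAffine.negY x y = 2 * y + W.a₁ * x + W.a₃ := by
    rw [WeierstrassCurve.Affine.negY]; ring
  rw [hD'] at hℓ hsq
  rw [← hsq, WeierstrassCurve.Affine.addX, dupNum, WeierstrassCurve.b₄, WeierstrassCurve.b₆, WeierstrassCurve.b₈]
  simp only [WeierstrassCurve.toAffine]
  linear_combination (ℓ * (2 * y + W.a₁ * x + W.a₃) + (3 * x ^ 2 + 2 * W.a₂ * x + W.a₄ - W.a₁ * y) +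
      W.a₁ * (2 * y + W.a₁ * x + W.a₃)) * hℓ + (-(W.a₁) ^ 2 - 4 * W.a₂ - 8 * x) * h

/-- **The square identity**: for every root `e` of `ψ₂`,
`x⁴ − b₄x² − 2b₆x − b₈ − e·ψ₂(x) = (x² − 2ex − (b₄ + b₂e + 4e²)/2)²` (uses `4b₈ = b₂b₆ − b₄²`). -/
theorem four_mul_dupNum_sub_root_mul_psiTwo (W : WeierstrassCurve F) {e : F} (he : psiTwo W e = 0) (x : F) :
    4 * (dupNum W x - e * psiTwo W x) = (2 * x ^ 2 - 4 * e * x - (W.b₄ + W.b₂ * e + 4 * e ^ 2)) ^ 2 := by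
  have hb := W.b_relation
  rw [psiTwo] at he
  rw [dupNum, psiTwo]
  linear_combination (-1 : F) * hb + (-(8 : F) * x - 4 * e - W.b₂) * he

/-- `ψ₂` commutes with base change. -/
theorem psiTwo_map {K : Type*} [Field K] (W : WeierstrassCurve F) (φ : F →+* K) (x : F) :
    psiTwo (W.map φ) (φ x) = φ (psiTwo W x) := by
  simp [psiTwo, WeierstrassCurve.map_b₂, WeierstrassCurve.map_b₄, WeierstrassCurve.map_b₆, map_ofNat]

/-- `dupNum` commutes with base change. -/
theorem dupNum_map {K : Type*} [Field K] (W : WeierstrassCurve F) (φ : F →+* K) (x : F) :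
    dupNum (W.map φ) (φ x) = φ (dupNum W x) := by
  simp [dupNum, WeierstrassCurve.map_b₄, WeierstrassCurve.map_b₆, WeierstrassCurve.map_b₈, map_ofNat]

/-- **Root domination.** For `W/ℚ`, an affine point `(u, v)` with `v ≠ negY u v` and any `X : ℚ` with
`X · ψ₂(u) = dupNum(u)` (e.g. `X = x(2(u,v))`), `X` is `≥` every real root of `ψ₂`: `X` is not on the egg. -/
theorem not_onEgg_of_mul_psiTwo_eq (W : WeierstrassCurve ℚ) {u v X : ℚ} (h : W.toAffine.Equation u v)
    (hv : v ≠ W.toAffine.negY u v) (hmulX : X * psiTwo W u = dupNum W u) : ¬ OnEgg W X := by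
  rintro ⟨e, he, hlt⟩
  set φ : ℚ →+* ℝ := algebraMap ℚ ℝ with hφ
  have hφq : ∀ q : ℚ, φ q = (q : ℝ) := fun q => eq_ratCast φ q
  -- the real root is a root of `ψ₂` of the base-changed curve
  have he' : psiTwo (W.map φ) e = 0 := by
    rw [psiTwo, WeierstrassCurve.map_b₂, WeierstrassCurve.map_b₄, WeierstrassCurve.map_b₆, hφq, hφq, hφq]
    exact he
  -- rational identities
  have hpsi := sub_negY_sq_eq_psiTwo W h
  have hD : v - W.toAffine.negY u v ≠ 0 := sub_ne_zero.mpr hv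
  have hposQ : (0 : ℚ) < psiTwo W u := by rw [← hpsi]; positivity
  have hpos : (0 : ℝ) < ((psiTwo W u : ℚ) : ℝ) := by exact_mod_cast hposQ
  -- the square identity over `ℝ`, pulled back along `φ`
  have hsq := four_mul_dupNum_sub_root_mul_psiTwo (W.map φ) he' (φ u)
  rw [psiTwo_map, dupNum_map, hφq, hφq] at hsq
  have hnonneg : (0 : ℝ) ≤ ((dupNum W u : ℚ) : ℝ) - e * ((psiTwo W u : ℚ) : ℝ) := by
    nlinarith [hsq, sq_nonneg (2 * φ u ^ 2 - 4 * e * φ u - ((W.map φ).b₄ + (W.map φ).b₂ * e + 4 * e ^ 2))]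
  have hprod : ((X : ℚ) : ℝ) * ((psiTwo W u : ℚ) : ℝ) = ((dupNum W u : ℚ) : ℝ) := by exact_mod_cast hmulX
  have hkey : (0 : ℝ) ≤ (((X : ℚ) : ℝ) - e) * ((psiTwo W u : ℚ) : ℝ) := by
    have : (((X : ℚ) : ℝ) - e) * ((psiTwo W u : ℚ) : ℝ) = ((dupNum W u : ℚ) : ℝ) - e * ((psiTwo W u : ℚ) : ℝ) := by
      rw [← hprod]; ring
    rw [this]; exact hnonneg
  have hneg : (((X : ℚ) : ℝ) - e) * ((psiTwo W u : ℚ) : ℝ) < 0 :=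
    mul_neg_of_neg_of_pos (sub_neg.mpr hlt) hpos
  linarith

/-- **Doubling lands off the egg (abscissa form).** For `W/ℚ` and a rational affine point `Q = (x, y)` on `W`
with `2Q ≠ 0` (`y ≠ negY`), the abscissa `X(2Q) = addX x x (slope x x y y)` is `≥` every real root of `ψ₂`,
so it is not on the egg. -/
theorem not_onEgg_addX_self [DecidableEq ℚ] (W : WeierstrassCurve ℚ) {x y : ℚ} (h : W.toAffine.Equation x y)
    (hy : y ≠ W.toAffine.negY x y) :
    ¬ OnEgg W (W.toAffine.addX x x (W.toAffine.slope x x y y)) :=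
  not_onEgg_of_mul_psiTwo_eq W h hy (addX_self_mul_psiTwo W h hy)

/-- **Doubling lands off the egg (point form): `2E(ℚ)` misses the egg.** If `Q + Q = (x', y')` for a rational
point `Q` of `W/ℚ`, then `x'` is not on the egg. (So the real-component map `E(ℚ) → π₀(E(ℝ))` factors through
`E(ℚ)/2E(ℚ)`: the well-definedness half of -desc's descent sign, and the real half of the EGG LEMMA.) -/
theorem not_onEgg_of_add_self_eq (W : WeierstrassCurve ℚ) (Q : W.toAffine.Point) {x' y' : ℚ}
    (h' : W.toAffine.Nonsingular x' y') (hQ : Q + Q = WeierstrassCurve.Affine.Point.some x' y' h') :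
    ¬ OnEgg W x' := by
  rcases Q with _ | ⟨x, y, h⟩
  · rw [← WeierstrassCurve.Affine.Point.zero_def, add_zero] at hQ
    exact absurd hQ.symm (WeierstrassCurve.Affine.Point.some_ne_zero _)
  · by_cases hy : y = W.toAffine.negY x y
    · rw [WeierstrassCurve.Affine.Point.add_self_of_Y_eq hy] at hQ
      exact absurd hQ.symm (WeierstrassCurve.Affine.Point.some_ne_zero _)
    · rw [WeierstrassCurve.Affine.Point.add_self_of_Y_ne hy, WeierstrassCurve.Affine.Point.some.injEq] at hQ
      rw [← hQ.1]
      exact not_onEgg_addX_self W h.1 hy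

/-- `2 • Q` form of `not_onEgg_of_add_self_eq`. -/
theorem not_onEgg_of_two_smul_eq (W : WeierstrassCurve ℚ) (Q : W.toAffine.Point) {x' y' : ℚ}
    (h' : W.toAffine.Nonsingular x' y') (hQ : 2 • Q = WeierstrassCurve.Affine.Point.some x' y' h') :
    ¬ OnEgg W x' :=
  not_onEgg_of_add_self_eq W Q h' (by rwa [two_nsmul] at hQ)

/-- `E(ℚ)[2] = 0` in point form: under `NoRationalTwoTorsion`, `2 • P = 0 → P = 0`. -/
theorem eq_zero_of_two_smul_eq_zero (W : WeierstrassCurve ℚ) (hT : NoRationalTwoTorsion W)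
    (P : W.toAffine.Point) (h2 : 2 • P = 0) : P = 0 := by
  rcases P with _ | ⟨x, y, h⟩
  · rfl
  · exfalso
    rw [two_nsmul] at h2
    by_cases hy : y = W.toAffine.negY x y
    · apply hT x
      refine ⟨y, h.1, ?_⟩
      rw [WeierstrassCurve.Affine.negY] at hy
      linear_combination hy
    · rw [WeierstrassCurve.Affine.Point.add_self_of_Y_ne hy] at h2
      exact WeierstrassCurve.Affine.Point.some_ne_zero _ h2

/-- In an additive commutative group without `2`-torsion, `2^a • g = 0 → g = 0`. -/
theorem eq_zero_of_two_pow_smul_eq_zero' {G : Type*} [AddCommGroup G] (hG : ∀ g : G, 2 • g = 0 → g = 0)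
    (a : ℕ) : ∀ g : G, 2 ^ a • g = 0 → g = 0 := by
  induction a with
  | zero => intro g hg; simpa using hg
  | succ a ih =>
      intro g hg
      have h' : 2 ^ a • (2 • g) = 0 := by
        rw [← mul_nsmul', ← pow_succ]; exact hg
      exact hG g (ih _ h')

/-- In an additive commutative group without `2`-torsion, every torsion element is twice a (torsion)
element: `t = 2 • ((k+1) • t)` for `t` of odd order `2k+1`. -/
theorem torsion_eq_two_smul' {G : Type*} [AddCommGroup G] (hG : ∀ g : G, 2 • g = 0 → g = 0)
    (t : G) (ht : t ∈ AddCommGroup.torsion G) : ∃ t₁ : G, t = 2 • t₁ := by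
  rw [AddCommGroup.mem_torsion, isOfFinAddOrder_iff_nsmul_eq_zero] at ht
  obtain ⟨m, hm, hmt⟩ := ht
  obtain ⟨a, m', hm', hmeq⟩ := Nat.exists_eq_two_pow_mul_odd hm.ne'
  have hm't : m' • t = 0 := by
    apply eq_zero_of_two_pow_smul_eq_zero' hG a
    rw [← mul_nsmul', ← hmeq]; exact hmt
  obtain ⟨k, hk⟩ := hm'
  refine ⟨(k + 1) • t, ?_⟩
  rw [← mul_nsmul', show 2 * (k + 1) = m' + 1 by omega, add_nsmul, hm't, one_nsmul, zero_add]

/-- Under `NoRationalTwoTorsion`, `2^a • P = 0 → P = 0`. -/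
theorem eq_zero_of_two_pow_smul_eq_zero (W : WeierstrassCurve ℚ) (hT : NoRationalTwoTorsion W)
    (a : ℕ) : ∀ P : W.toAffine.Point, 2 ^ a • P = 0 → P = 0 :=
  eq_zero_of_two_pow_smul_eq_zero' (eq_zero_of_two_smul_eq_zero W hT) a

/-- Under `NoRationalTwoTorsion`, every rational torsion point is twice a rational (torsion) point. -/
theorem torsion_eq_two_smul (W : WeierstrassCurve ℚ) (hT : NoRationalTwoTorsion W)
    (t : W.toAffine.Point) (ht : t ∈ AddCommGroup.torsion W.toAffine.Point) :
    ∃ t₁ : W.toAffine.Point, t = 2 • t₁ :=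
  torsion_eq_two_smul' (eq_zero_of_two_smul_eq_zero W hT) t ht

/-- **RATIONAL EGG LEMMA.** `E(ℚ)[2] = 0`: a rational point on the egg is not in `2E(ℚ) + E(ℚ)_tors`.
(The `K`-version of MEMO-an §2 AN-13 — `K` imaginary quadratic — reduces to this one by Galois descent
`Q' = σQ' ⇒ Q' ∈ E(ℚ)` once `E(K)[2] = 0`; that step is not formalised here.) -/
theorem onEgg_not_two_smul_add_torsion (W : WeierstrassCurve ℚ) (hT : NoRationalTwoTorsion W)
    {x y : ℚ} (h : W.toAffine.Nonsingular x y) (hegg : OnEgg W x) :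
    ¬ ∃ Q t : W.toAffine.Point, t ∈ AddCommGroup.torsion W.toAffine.Point ∧
        WeierstrassCurve.Affine.Point.some x y h = 2 • Q + t := by
  rintro ⟨Q, t, ht, hR⟩
  obtain ⟨t₁, rfl⟩ := torsion_eq_two_smul W hT t ht
  rw [← nsmul_add] at hR
  exact not_onEgg_of_two_smul_eq W (Q + t₁) h hR.symm hegg

section OverK

open scoped Classical

/-- A rational root of `ψ₂` is the abscissa of a rational `2`-torsion point (`y = -(a₁e + a₃)/2`). -/
theorem hasRationalTwoTorsionX_of_psiTwo_eq_zero (W : WeierstrassCurve ℚ) {e : ℚ} (he : psiTwo W e = 0) :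
    Literature.NumberTheory.EllipticCurves.Greenberg1999.HasRationalTwoTorsionX W e := by
  refine ⟨-(W.a₁ * e + W.a₃) / 2, ?_, by ring⟩
  rw [WeierstrassCurve.Affine.equation_iff]
  rw [psiTwo, WeierstrassCurve.b₂, WeierstrassCurve.b₄, WeierstrassCurve.b₆] at he
  linear_combination (-1 / 4 : ℚ) * he

/-- Under `NoRationalTwoTorsion`, `ψ₂` has no rational root. -/
theorem psiTwo_ne_zero (W : WeierstrassCurve ℚ) (hT : NoRationalTwoTorsion W) (e : ℚ) : psiTwo W e ≠ 0 :=
  fun he => hT e (hasRationalTwoTorsionX_of_psiTwo_eq_zero W he)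

/-- **A cubic with no rational root has no root in a quadratic field**: under `NoRationalTwoTorsion`, `ψ₂` has
no root in any `K` with `[K : ℚ] = 2` (if `u ∉ ℚ`, `u² = α + βu` splits off a rational linear factor). -/
theorem psiTwo_baseChange_ne_zero (W : WeierstrassCurve ℚ) (hT : NoRationalTwoTorsion W)
    {K : Type*} [Field K] [Algebra ℚ K] (h2 : Module.finrank ℚ K = 2) (u : K) :
    psiTwo (W.baseChange K) u ≠ 0 := by
  intro hu
  set φ : ℚ →+* K := algebraMap ℚ K with hφ
  have hψ : psiTwo (W.baseChange K) u = 4 * u ^ 3 + φ W.b₂ * u ^ 2 + 2 * φ W.b₄ * u + φ W.b₆ := by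
    simp [psiTwo, WeierstrassCurve.baseChange, WeierstrassCurve.map_b₂, WeierstrassCurve.map_b₄,
      WeierstrassCurve.map_b₆, hφ]
  by_cases hmem : u ∈ Set.range φ
  · obtain ⟨q, rfl⟩ := hmem
    have e1 : psiTwo (W.baseChange K) (φ q) = φ (psiTwo W q) := psiTwo_map W φ q
    rw [e1, map_eq_zero_iff φ φ.injective] at hu
    exact psiTwo_ne_zero W hT q hu
  · obtain ⟨α, β, hαβ⟩ :=
      Literature.NumberTheory.QuadraticFields.Quadratic.exists_eq_add_mul (F := ℚ) h2 hmem (u * u)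
    -- `f(u) = (u² - βu - α)(4u + γ) + c₁ u + c₀` with `γ = b₂ + 4β`
    set c₁ : ℚ := 4 * α + 4 * β ^ 2 + W.b₂ * β + 2 * W.b₄ with hc₁
    set c₀ : ℚ := 4 * α * β + α * W.b₂ + W.b₆ with hc₀
    have hlin : φ c₀ + φ c₁ * u = 0 := by
      rw [hψ] at hu
      simp only [hc₀, hc₁, map_add, map_mul, map_pow, map_ofNat]
      linear_combination hu - (4 * u + φ W.b₂ + 4 * φ β) * hαβ
    -- linear independence of `1, u` over `ℚ`
    have hc₁0 : c₁ = 0 := by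
      by_contra hne
      apply hmem
      refine ⟨-c₀ / c₁, ?_⟩
      have hne' : φ c₁ ≠ 0 := (map_ne_zero_iff φ φ.injective).mpr hne
      rw [map_div₀, map_neg, div_eq_iff hne']
      linear_combination -hlin
    have hc₀0 : c₀ = 0 := by
      rw [hc₁0, map_zero, zero_mul, add_zero, map_eq_zero_iff φ φ.injective] at hlin
      exact hlin
    -- the rational root `e = -(b₂ + 4β)/4`
    apply psiTwo_ne_zero W hT (-(W.b₂ + 4 * β) / 4)
    have hid : psiTwo W (-(W.b₂ + 4 * β) / 4)
        = ((-(W.b₂ + 4 * β) / 4) ^ 2 - β * (-(W.b₂ + 4 * β) / 4) - α) * (4 * (-(W.b₂ + 4 * β) / 4) + (W.b₂ + 4 * β))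
          + c₁ * (-(W.b₂ + 4 * β) / 4) + c₀ := by
      rw [psiTwo, hc₁, hc₀]; ring
    rw [hid, hc₁0, hc₀0]; ring

/-- **`E(K)[2] = 0` for quadratic `K`** under `NoRationalTwoTorsion`: `2 • P = 0 → P = 0` in `E(K)`. -/
theorem eq_zero_of_two_smul_eq_zero_baseChange (W : WeierstrassCurve ℚ) (hT : NoRationalTwoTorsion W)
    {K : Type*} [Field K] [Algebra ℚ K] (h2 : Module.finrank ℚ K = 2)
    (P : (W.baseChange K).toAffine.Point) (hP : 2 • P = 0) : P = 0 := by
  rcases P with _ | ⟨u, v, huv⟩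
  · rfl
  · exfalso
    rw [two_nsmul] at hP
    by_cases hv : v = (W.baseChange K).toAffine.negY u v
    · apply psiTwo_baseChange_ne_zero W hT h2 u
      rw [← sub_negY_sq_eq_psiTwo (W.baseChange K) huv.1, ← hv, sub_self, zero_pow two_ne_zero]
    · rw [WeierstrassCurve.Affine.Point.add_self_of_Y_ne hv] at hP
      exact WeierstrassCurve.Affine.Point.some_ne_zero _ hP

/-- **Galois descent of halves.** `K/ℚ` quadratic, `E(K)[2] = 0`: if a rational point `R` is twice a
`K`-point `Q'`, then `Q'` is rational (`2Q' = R = σR = 2σQ' ⇒ Q' = σQ'`, and `σ`-fixed points of `E(K)`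
come from `E(ℚ)`). -/
theorem exists_incl_eq_of_two_smul (W : WeierstrassCurve ℚ) {K : Type*} [Field K] [Algebra ℚ K]
    (h2 : Module.finrank ℚ K = 2)
    (hT2 : ∀ P : (W.baseChange K).toAffine.Point, 2 • P = 0 → P = 0)
    (R : W.toAffine.Point) (Q' : (W.baseChange K).toAffine.Point)
    (hR : WeierstrassCurve.QuadraticDescent.incl K W R = 2 • Q') :
    ∃ Q₀ : W.toAffine.Point, WeierstrassCurve.QuadraticDescent.incl K W Q₀ = Q' := by
  obtain ⟨θ, c, hθ, hc⟩ :=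
    Literature.NumberTheory.QuadraticFields.Quadratic.exists_sq_eq_algebraMap (F := ℚ) (K := K) h2
  set σ := Literature.NumberTheory.QuadraticFields.Quadratic.conj h2 hθ hc with hσ
  -- `σ` fixes `ι R`, hence `2 • σQ' = 2 • Q'`, hence `σQ' = Q'`
  have hfixR : WeierstrassCurve.QuadraticDescent.conjMap W σ (WeierstrassCurve.QuadraticDescent.incl K W R)
      = WeierstrassCurve.QuadraticDescent.incl K W R :=
    WeierstrassCurve.QuadraticDescent.conjMap_incl W σ R
  have h2eq : 2 • (WeierstrassCurve.QuadraticDescent.conjMap W σ Q' - Q') = 0 := by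
    rw [smul_sub, ← map_nsmul, ← hR, hfixR, sub_self]
  have hfixQ : WeierstrassCurve.QuadraticDescent.conjMap W σ Q' = Q' := sub_eq_zero.mp (hT2 _ h2eq)
  -- `σ`-fixed points come from `ℚ`
  rcases Q' with _ | ⟨u, v, huv⟩
  · exact ⟨0, rfl⟩
  · rw [WeierstrassCurve.Affine.Point.map_some, WeierstrassCurve.Affine.Point.some.injEq] at hfixQ
    obtain ⟨a, ha⟩ :=
      Literature.NumberTheory.QuadraticFields.Quadratic.exists_eq_algebraMap_of_conj_eq h2 hθ hc hfixQ.1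
    obtain ⟨b, hb⟩ :=
      Literature.NumberTheory.QuadraticFields.Quadratic.exists_eq_algebraMap_of_conj_eq h2 hθ hc hfixQ.2
    exact WeierstrassCurve.QuadraticDescent.exists_incl_eq W huv ha.symm hb.symm

/-- **EGG LEMMA (quadratic `K`).** `E(ℚ)[2] = 0` and `E(K)[2] = 0` for a quadratic field `K`: a rational
point on the egg is not in `2E(K) + E(K)_tors`. With `K` imaginary quadratic this is the real-place lemma of
MEMO-an §2 AN-13 (`b(E,K) = [y_K ∉ E⁰(ℝ)]` is an invariant of `y_K` up to `2E(K) + torsion`). -/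
theorem onEgg_not_two_smul_add_torsion_baseChange (W : WeierstrassCurve ℚ)
    {K : Type*} [Field K] [Algebra ℚ K] (h2 : Module.finrank ℚ K = 2)
    (hT2 : ∀ P : (W.baseChange K).toAffine.Point, 2 • P = 0 → P = 0)
    {x y : ℚ} (h : W.toAffine.Nonsingular x y) (hegg : OnEgg W x) :
    ¬ ∃ Q t : (W.baseChange K).toAffine.Point, t ∈ AddCommGroup.torsion (W.baseChange K).toAffine.Point ∧
        WeierstrassCurve.QuadraticDescent.incl K W (WeierstrassCurve.Affine.Point.some x y h)
          = 2 • Q + t := by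
  rintro ⟨Q, t, ht, hR⟩
  obtain ⟨t₁, rfl⟩ := torsion_eq_two_smul' hT2 t ht
  rw [← nsmul_add] at hR
  obtain ⟨Q₀, hQ₀⟩ := exists_incl_eq_of_two_smul W h2 hT2 _ (Q + t₁) hR
  rw [← hQ₀] at hR
  set φ : ℚ →+* K := algebraMap ℚ K with hφ
  have hK : (W.baseChange K).toAffine.Nonsingular (φ x) (φ y) :=
    (WeierstrassCurve.Affine.map_nonsingular (W := W.toAffine) φ.injective x y).mpr h
  have hιR : WeierstrassCurve.QuadraticDescent.incl K W (WeierstrassCurve.Affine.Point.some x y h)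
      = WeierstrassCurve.Affine.Point.some (φ x) (φ y) hK := rfl
  rcases Q₀ with _ | ⟨u, v, huv⟩
  · -- `ι 0 = 0`, so `ι R = 2 • 0 = 0`: impossible
    have h0 : WeierstrassCurve.QuadraticDescent.incl K W
        (WeierstrassCurve.Affine.Point.zero : W.toAffine.Point) = 0 := rfl
    rw [h0, smul_zero, hιR] at hR
    exact WeierstrassCurve.Affine.Point.some_ne_zero _ hR
  · have huvK : (W.baseChange K).toAffine.Nonsingular (φ u) (φ v) :=
      (WeierstrassCurve.Affine.map_nonsingular (W := W.toAffine) φ.injective u v).mpr huv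
    have hιQ : WeierstrassCurve.QuadraticDescent.incl K W (WeierstrassCurve.Affine.Point.some u v huv)
        = WeierstrassCurve.Affine.Point.some (φ u) (φ v) huvK := rfl
    rw [hιQ, hιR, two_nsmul] at hR
    have hnegY : (W.baseChange K).toAffine.negY (φ u) (φ v) = φ (W.toAffine.negY u v) :=
      WeierstrassCurve.Affine.map_negY (W' := W.toAffine) φ u v
    by_cases hvK : φ v = (W.baseChange K).toAffine.negY (φ u) (φ v)
    · rw [WeierstrassCurve.Affine.Point.add_self_of_Y_eq hvK] at hR
      exact WeierstrassCurve.Affine.Point.some_ne_zero _ hR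
    · rw [WeierstrassCurve.Affine.Point.add_self_of_Y_ne hvK, WeierstrassCurve.Affine.Point.some.injEq] at hR
      -- pull the duplication identity back to `ℚ`
      have hmulK := addX_self_mul_psiTwo (W.baseChange K) huvK.1 hvK
      have e1 : psiTwo (W.baseChange K) (φ u) = φ (psiTwo W u) := psiTwo_map W φ u
      have e2 : dupNum (W.baseChange K) (φ u) = φ (dupNum W u) := dupNum_map W φ u
      rw [← hR.1, e1, e2, ← map_mul] at hmulK
      have hmulX : x * psiTwo W u = dupNum W u := φ.injective hmulK
      have hv : v ≠ W.toAffine.negY u v := by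
        intro hv; exact hvK (by rw [hnegY, ← hv])
      exact not_onEgg_of_mul_psiTwo_eq W huv.1 hv hmulX hegg

/-- **EGG LEMMA (quadratic `K`, unconditional form).** `E(ℚ)[2] = 0` (`NoRationalTwoTorsion`) and
`[K : ℚ] = 2`: a rational point on the egg is not in `2E(K) + E(K)_tors`. -/
theorem onEgg_not_two_smul_add_torsion_quadratic (W : WeierstrassCurve ℚ) (hT : NoRationalTwoTorsion W)
    {K : Type*} [Field K] [Algebra ℚ K] (h2 : Module.finrank ℚ K = 2)
    {x y : ℚ} (h : W.toAffine.Nonsingular x y) (hegg : OnEgg W x) :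
    ¬ ∃ Q t : (W.baseChange K).toAffine.Point, t ∈ AddCommGroup.torsion (W.baseChange K).toAffine.Point ∧
        WeierstrassCurve.QuadraticDescent.incl K W (WeierstrassCurve.Affine.Point.some x y h)
          = 2 • Q + t :=
  onEgg_not_two_smul_add_torsion_baseChange W h2 (eq_zero_of_two_smul_eq_zero_baseChange W hT h2) h hegg

end OverK

section EggLemmaHolds

open scoped Classical

/-- **The EGG LEMMA holds** (kernel-checked; uses only `E(ℚ)[2] = 0` and `[K : ℚ] = 2` — neither `Δ > 0`
nor `K` imaginary nor `W` elliptic is needed). Closes the support statement `F1Sign2.EggLemma` of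
`EggLemmaAtTwo.lean` (REF2 v13 §2: folklore, theorem-grade). -/
theorem eggLemma : EggLemma := by
  intro W _ _ hT K _ _ hK P hP hQ
  obtain ⟨x, y, hKns, hegg, htor⟩ := hP
  obtain ⟨Q, hQ⟩ := hQ
  have h' : W.toAffine.Nonsingular x y :=
    (WeierstrassCurve.Affine.map_nonsingular (W := W.toAffine) (algebraMap ℚ K).injective x y).mp hKns
  have hιR : WeierstrassCurve.QuadraticDescent.incl K W (WeierstrassCurve.Affine.Point.some x y h')
      = WeierstrassCurve.Affine.Point.some (algebraMap ℚ K x) (algebraMap ℚ K y) hKns := rfl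
  apply onEgg_not_two_smul_add_torsion_quadratic W hT hK.1 h' hegg
  refine ⟨Q, (P - 2 • Q) - (P - WeierstrassCurve.Affine.Point.some _ _ hKns), sub_mem hQ htor, ?_⟩
  rw [hιR]; abel

end EggLemmaHolds

end Summit.BirchSwinnertonDyer.Rank1Residual.F1Sign2.EggDoubling

end
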